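import Mathlib.MeasureTheory.Constructions.Pi
import Mathlib.MeasureTheory.Integral.Bochner.Basic
import Mathlib.MeasureTheory.Measure.Lebesgue.Basic
import Mathlib.Analysis.SpecialFunctions.Trigonometric.Basic
import Mathlib.Analysis.SpecialFunctions.Exp
import Mathlib.Analysis.Normed.Group.Constructions
import Literature.Probability.LatticeModels.VillainMonotonicity
import Literature.Probability.LatticeModels.LatticeGreenFunction
import HarnessLib

/-!
# Fröhlich–Spencer 1982 (as printed in Dario–Wu 2020, Prop. 1.1): long-range order and the
# two-sided spin-wave bound for the classical Villain rotator in `ℤ^d`, `d ≥ 3`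

Topic `Literature/Probability/LatticeModels` (next to `VillainMonotonicity.lean`, whose
`villainSpinWeight` / `angleCube` idiom — Lebesgue integration of angle configurations over
`[-π, π)^V` against a product of the periodised Gaussians
`Literature.MathematicalPhysics.QuantumFieldTheory.villainKernel` — is reused here).
This file holds ONE NAMED FACT and the three small definitions it needs; nothing is proved.

## The model (as printed)

P. Dario, W. Wu, *Massless phases for the Villain model in `d ≥ 3`*, arXiv:2002.02946
(Astérisque, to appear) [DarioWu2020], Ch. 1 §1 (PDF p. 4): "Given a finite cube `□ ⊂ ℤ^d`, we
denote by `□°` its interior, `∂□` its boundary and `E(□)` its edge set. The Villain model on the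
cube `□` with zero boundary condition is given by the following Gibbs measure
`dμ^V_{β,□,0}(θ) := Z_{□,0}⁻¹ ∏_{(x,y) ⊂ E(□)} v_β(θ(x) − θ(y)) ∏_{x ∈ ∂□} δ_0(θ(x))
∏_{x ∈ □°} 1_{[-π,π)}(θ(x)) dθ` where `v_β(θ) = ∑_{m ∈ ℤ} exp(−(β/2)(θ + 2πm)²)` is the heat
kernel on `S¹`"; "`S_x = (cos θ(x), sin θ(x))`. By the `θ → −θ` symmetry, we have
`⟨S_0 · S_x⟩_{μ^V_{β,□,0}} = ⟨e^{i(θ(0) − θ(x))}⟩_{μ^V_{β,□,0}}`"; "It is known that, as a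
consequence of correlation inequalities [Gi, BFL, MMP], the thermodynamic limit of the measures
… exists as `□ → ℤ^d`. We denote by `μ^V_β` the corresponding infinite volume Gibbs measure."
Here `v_β = villainKernel β` (tree), the cube is the centred cube `box d (n+1) = {-(n+1),…,n+1}^d`
(tree `box`) with interior `box d n` and boundary the shell; `dirichletVillainTwoPoint β n x` is
`⟨S_0 · S_x⟩_{μ^V_{β,□,0}} = ⟨cos(θ(0) − θ(x))⟩` on that cube, and the thermodynamic limit is
taken along `n → ∞` inside the fact (its existence is part of what is printed).

## The fact (as printed)

DarioWu2020, Proposition 1.1 (PDF pp. 4–5), attributed there to Fröhlich–Spencer,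
Comm. Math. Phys. 83 (1982) 411–454 [FrohlichSpencerCMP1982] ("[FS4d] observed that the
classical Villain model in `ℤ^d` can be mapped, via duality, to a statistical mechanical model of
lattice Coulomb gas, with local neutrality constraints. They further employed a one step
renormalization argument and gave the following next order description of the two-point function
at low temperature."):

"**Proposition 1.1** ([FS4d]). Let `μ^V_β` be the thermodynamic limit of the Villain model in
`ℤ^d`, for `d ≥ 3`. There exist constants `β₀ = β₀(d)`, `c₀ = c₀(β,d)`, such that for all
`β > β₀`, `⟨S_0 · S_x⟩_{μ^V_β} = c₀ + O(1/|x|^{d−2})`. Moreover, as `β → ∞`,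
`exp((δ_0 − δ_x, −(1/2β) Δ⁻¹(δ_0 − δ_x))) ≥ ⟨S_0 · S_x⟩_{μ^V_β}
 ≥ exp((δ_0 − δ_x, (−1/(2β) + o(1/β)) Δ⁻¹(δ_0 − δ_x)))`."

(The primary source FS82 is paywalled/cite-only on this hub, acq-00340; the statement is vendored
from the secondary source, exactly as the sibling facts `FrohlichSpencerU1PerimeterLawD4` /
`FrohlichSpencerVillainMasslessPhotonD4` were.) Reading of the printed symbols used below:
`Δ` is the nearest-neighbour lattice Laplacian of `ℤ^d` (tree `latticeLaplacianZd`), and by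
`latticeLaplacianZd_half_latticeGreen` (`−Δ (latticeGreen/2) = δ_0`, `d ≥ 3`) and
`latticeGreen_neg` the printed quadratic form is
`(δ_0 − δ_x, (−Δ)⁻¹(δ_0 − δ_x)) = latticeGreen 0 − latticeGreen x ≥ 0`, so that the printed
exponents `−(1/2β)·(…)` are `−(latticeGreen 0 − latticeGreen x)/(2β)` (the Gaussian spin-wave
value); `O(1/|x|^{d−2})` is transcribed as `|G(x) − c₀| ≤ C/‖x‖^{d−2}` for all `x ≠ 0`
(`‖·‖` the sup norm on `Site d = Fin d → ℤ`, `‖x‖ ≥ 1` for `x ≠ 0`, equivalent to the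
asymptotic `O` since `|G| ≤ 1`); `o(1/β)` is a function `r(β)` of `β` alone with `β·r(β) → 0`;
"as `β → ∞`" and "`β > β₀`" are merged into one existential threshold (weaker than printed, hence
safe as a hypothesis).

## Use

Grounds `Summit.HubbardSuperconductivity.HubbardSuperconductivity.Theses.AposterioriCapRg.XYOrderOpennessLargeSpin`
(stmt-HubbardSuperconductivity-13895) and `…AposterioriCapRg.AposterioriOrderCriterionR`
(stmt-HubbardSuperconductivity-13884): the route's η > 0 "duality lever" is exactly this
RP-free low-temperature LRO bound for the abelian (2+1)/3-dimensional Villain / integer-current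
gas ("FrohlichSpencerCMP1982 as quoted in DarioWu2020 Prop 1.1"); its first lemma
(AnisotropicVillainLRO: the same lower bound for direction-dependent stiffness `(β_s, β_s, β_τ)`
on `ℤ²×ℤ`, uniformly in `β_τ/β_s → ∞` at fixed `√(β_s β_τ)`) is NOT printed and is not part of
this fact; the anisotropic finite-volume model itself needs no new definition — it is
`villainTwoPoint s t κ` of `VillainMonotonicity.lean` on the box graph with an edge-direction
dependent `κ`. Corollary available to users by `0 ≤ latticeGreen x ≤ latticeGreen 0`
(`latticeGreen_nonneg`, maximum at `0`): `⟨S_0 · S_x⟩_{μ^V_β} ≥ exp(−(1/(2β) + |r β|)·latticeGreen 0)`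
uniformly in `x` — long-range order `1 − O(1/β)` without reflection positivity.

## References

* [DarioWu2020] P. Dario, W. Wu, arXiv:2002.02946, Ch. 1 §1, Proposition 1.1 (PDF pp. 4–5),
  Theorem 1 (p. 5).
* [FrohlichSpencerCMP1982] J. Fröhlich, T. Spencer, Comm. Math. Phys. 83 (1982) 411–454
  (the source of Prop. 1.1; cite-only here, acq-00340).
-/

noncomputable section

open MeasureTheory Filter Topology

namespace Literature.Probability.LatticeModels

variable {d : ℕ}

/-- Zero (Dirichlet) boundary extension of an angle configuration given on the interior
`box d n = {-n,…,n}^d` of the cube `box d (n+1)`: `θ̄(x) = θ(x)` for `x ∈ box d n` and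
`θ̄(x) = 0` otherwise (in particular on the boundary shell `∂□ = box d (n+1) \ box d n`, the
factor `∏_{x ∈ ∂□} δ_0(θ(x))` of the printed measure).
[cite: DarioWu2020, Ch. 1 §1 eq. (1.1) (PDF p. 4), zero boundary condition] -/
def dirichletExtend (n : ℕ) (θ : ↥(box d n) → ℝ) (x : Site d) : ℝ :=
  if h : x ∈ box d n then θ ⟨x, h⟩ else 0

/-- The Villain Gibbs weight of the cube `□ = box d (n+1)` with zero boundary condition, as a
function of the interior angles `θ : box d n → ℝ`:
`∏_{(x,y) ∈ E(□)} v_β(θ̄(y) − θ̄(x))`, the product over the nearest-neighbour edges of the cube,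
each edge `{x, x + e_i}` (both ends in `□`) taken once; `v_β = villainKernel β` is even, so the
orientation is immaterial; edges with both ends on the boundary contribute the constant
`v_β(0)`, which cancels in every expectation.
[cite: DarioWu2020, Ch. 1 §1 eq. (1.1) (PDF p. 4)] -/
def dirichletVillainWeight (β : ℝ) (n : ℕ) (θ : ↥(box d n) → ℝ) : ℝ :=
  ∏ x ∈ box d (n + 1), ∏ i : Fin d,
    if x + Pi.single i 1 ∈ box d (n + 1) then
      Literature.MathematicalPhysics.QuantumFieldTheory.villainKernel β
        (dirichletExtend n θ (x + Pi.single i 1) - dirichletExtend n θ x)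
    else 1

/-- The finite-volume two-point function `⟨S_0 · S_x⟩_{μ^V_{β,□,0}} = ⟨cos(θ(0) − θ(x))⟩`
of the Villain model on the cube `□ = box d (n+1)` with zero boundary condition
(`= ⟨e^{i(θ(0)−θ(x))}⟩` by the `θ → −θ` symmetry): the ratio
`(∫_{[-π,π)^{□°}} cos(θ̄(0) − θ̄(x)) w dθ) / (∫_{[-π,π)^{□°}} w dθ)` with `w = dirichletVillainWeight β n`
and Lebesgue measure on the interior angles (`angleCube`). For `x ∉ box d n` the spin at `x` is the
boundary value (`θ̄(x) = 0`); only the limit `n → ∞` at fixed `x` is used.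
[cite: DarioWu2020, Ch. 1 §1 (PDF p. 4), `⟨S_0·S_x⟩_{μ^V_{β,□,0}}`] -/
def dirichletVillainTwoPoint (β : ℝ) (n : ℕ) (x : Site d) : ℝ :=
  (∫ θ in angleCube ↥(box d n),
      Real.cos (dirichletExtend n θ 0 - dirichletExtend n θ x) * dirichletVillainWeight β n θ) /
    ∫ θ in angleCube ↥(box d n), dirichletVillainWeight β n θ

/-- NAMED FACT — **Fröhlich–Spencer 1982, as printed in Dario–Wu 2020, Proposition 1.1**
(low-temperature Villain rotator in `ℤ^d`, `d ≥ 3`: long-range order with Gaussian spin-wave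
two-sided bounds, NO reflection positivity). "Let `μ^V_β` be the thermodynamic limit of the
Villain model in `ℤ^d`, for `d ≥ 3`. There exist constants `β₀ = β₀(d)`, `c₀ = c₀(β,d)`, such that
for all `β > β₀`, `⟨S_0 · S_x⟩_{μ^V_β} = c₀ + O(1/|x|^{d−2})`. Moreover, as `β → ∞`,
`exp((δ_0 − δ_x, −(1/2β)Δ⁻¹(δ_0 − δ_x))) ≥ ⟨S_0 · S_x⟩_{μ^V_β} ≥
exp((δ_0 − δ_x, (−1/(2β) + o(1/β))Δ⁻¹(δ_0 − δ_x)))`." Transcription (module docstring): for every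
`d ≥ 3` there are a threshold `β₀ > 0` and a correction `r : ℝ → ℝ` with `β·r(β) → 0` such that for
every `β > β₀` there are `c₀, C` with, for every site `x`, the zero-boundary-condition cube two-point
functions `dirichletVillainTwoPoint β n x` converging (thermodynamic limit, printed as known from
correlation inequalities) to a limit `G` satisfying `|G − c₀| ≤ C/‖x‖^{d−2}` (`x ≠ 0`) and
`exp(−(1/(2β) + r β)·g(x)) ≤ G ≤ exp(−g(x)/(2β))` — written below with `+ r β`, `r` of either
sign — where `g(x) = (δ_0 − δ_x, (−Δ)⁻¹(δ_0 − δ_x)) = latticeGreen 0 − latticeGreen x`. Not proved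
here (FS82: duality to a lattice Coulomb gas + one renormalisation step). Users take
`(h : FrohlichSpencerVillainSpinWaveBound)`.
[cite: DarioWu2020, Proposition 1.1 (PDF pp. 4–5), quoting FrohlichSpencerCMP1982]
Grounds `Summit.HubbardSuperconductivity.HubbardSuperconductivity.Theses.AposterioriCapRg.XYOrderOpennessLargeSpin`
and `Summit.HubbardSuperconductivity.HubbardSuperconductivity.Theses.AposterioriCapRg.AposterioriOrderCriterionR`
(their RP-free "duality lever"; the items themselves are NOT this fact). -/
def FrohlichSpencerVillainSpinWaveBound : Prop :=
  ∀ d : ℕ, 3 ≤ d →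
    ∃ β₀ : ℝ, 0 < β₀ ∧
    ∃ r : ℝ → ℝ, Tendsto (fun β : ℝ => β * r β) atTop (𝓝 0) ∧
      ∀ β : ℝ, β₀ < β →
        ∃ c₀ C : ℝ, ∀ x : Site d, ∃ G : ℝ,
          Tendsto (fun n : ℕ => dirichletVillainTwoPoint (d := d) β n x) atTop (𝓝 G) ∧
          (x ≠ 0 → |G - c₀| ≤ C / ‖x‖ ^ (d - 2)) ∧
          G ≤ Real.exp (-(latticeGreen (0 : Site d) - latticeGreen x) / (2 * β)) ∧
          Real.exp ((-(1 / (2 * β)) + r β) * (latticeGreen (0 : Site d) - latticeGreen x)) ≤ G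

end Literature.Probability.LatticeModels

end
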